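import Literature.AlgebraicGeometry.Morphisms.FinsetInAffineOpenOfProjective
import HarnessLib

/-!
# Schemes affine over a `Proj`, and projective schemes over an affine base, have principal affine covers

Topic `Literature/AlgebraicGeometry/Morphisms`; THEOREMS only (no definition, no named fact, no instance). A **principal
affine cover** of a scheme `X` is a family of affine opens `U a` covering `X` whose pairwise intersections are PRINCIPAL
opens of the first member, `U a ∩ U c = D(b_{ac})` with `b_{ac} ∈ Γ(X, U a)` — the input currency `(U, b, hb)` of the
tree's Čech / deformation files (`Deformation/SmoothSchemeLiftObstructionCechCocycle`, …, `Morphisms/CechH1*`), for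
which `Γ(X, U a ∩ U c) = Γ(X, U a)_{b_{ac}}`.  THE PRINT: Hartshorne II Prop. 2.5 (b), proof: «`D₊(f) ∩ D₊(g) = D₊(fg)`»
and (2.5 (b)) «`D₊(f) ≅ Spec S_{(f)}`», under which `D₊(fg)` is the principal open of `g^{deg f}/f^{deg g} ∈ S_{(f)}`
(EGA II (2.3.3.2) / Stacks 00JP (3)); a scheme AFFINE over `Proj S` (e.g. a closed subscheme of `ℙⁿ_R`, or of
`ℙⁿ_ℤ ×_ℤ Y` for `Y` affine) inherits the principal affine cover by pull-back (Stacks 01JS: preimages of affines under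
affine morphisms are affine; `q⁻¹ D(s) = D(q♯ s)`).

* `exists_basicOpen_eq_opensRange_inf` — an open whose preimage under an open immersion `ι : Spec R ↪ P` is
  `D(e)` is the principal open `D(s)` of the image `V` of `ι`;
* `Proj.exists_basicOpen_inf_eq` — **`D₊(f) ∩ D₊(g)` is a principal open of the affine `D₊(f)`** (`f`, `g`
  homogeneous of positive degree; Mathlib `Proj.awayι_preimage_basicOpen`);
* **`exists_principal_affine_cover_of_isAffineHom_toProj`** — for `q : X → Proj 𝒜` AFFINE and positive-degree forms
  `f_a` with `⋃ D₊(f_a) = Proj 𝒜`: `U a := q⁻¹ D₊(f_a)` is a principal affine cover of `X`;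
* **`exists_principal_affine_cover_of_isProjective`** — a scheme PROJECTIVE (★ `Morphisms.IsProjective`,
  `X ↪ 𝐏(ι; Y) → Y`) over an AFFINE `Y` has a finite principal affine cover (through the affine map
  `X ↪ 𝐏(ι; Y) → ℙⁿ_ℤ = Proj ℤ[x₀, …, xₙ]` of ★ `FinsetInAffineOpenOfProjective` §2 and the standard opens `D₊(xᵢ)`).

Cell `hodgecm-mathlib`, F-11 road A (crux `HDel`): the producer of the `(U, b, hb)` input of the F2/F3/c2b chain for the
closed fibre `X_s` (MONO-G1) and, with ★ `Morphisms/NilpotentThickeningCoverLift` and the refinement sequel, of MONO-G2's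
cover subordinate to a trivialising cover. HC_CM is proved only modulo the 7 printed citations until rung 0 closes —
nothing here bears on a summit statement.

## References
* [Hartshorne1977] R. Hartshorne, *Algebraic Geometry*, GTM 52 (1977), II Prop. 2.5 (pp. 76–77) and its proof; II §4
  Definition p. 103 (projective morphisms).
* [StacksProject] The Stacks Project, Tag 00JP (basic opens of `Proj`), Tag 01MB (`Proj` as a scheme: the standard
  affine opens), Tag 01JS (affine morphisms).
* [GortzWedhorn2020] U. Görtz, T. Wedhorn, *Algebraic Geometry I*, 2nd ed. (2020), Prop. 13.6 / (13.3) (`D₊(f)` affine,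
  `D₊(f) ∩ D₊(g) = D₊(fg)`).
-/

noncomputable section

universe u

open CategoryTheory CategoryTheory.Limits AlgebraicGeometry TopologicalSpace
open Literature.AlgebraicGeometry.Motives

namespace Literature.AlgebraicGeometry.Morphisms

/-! ### §1 Principal opens through an open immersion from an affine scheme; `D₊(f) ∩ D₊(g)` -/

/-- **An open whose trace on an affine open chart is a basic open is a principal open of the chart**: for an open
immersion `ι : Spec R ↪ P` with image `V` and an open `W ⊆ P` with `ι⁻¹W = D(e)`, `V ∩ W = D(s)` for some
`s ∈ Γ(P, V)` (namely the image of `e`). [cite: StacksProject, Tag 01JS] [cite: Hartshorne1977, II Prop. 2.5 (proof)] -/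
theorem exists_basicOpen_eq_opensRange_inf {R : CommRingCat.{u}} {P : Scheme.{u}} (ι : Spec R ⟶ P)
    [IsOpenImmersion ι] (W : P.Opens) (e : R) (h : ι ⁻¹ᵁ W = PrimeSpectrum.basicOpen e) {V : P.Opens}
    (hV : ι.opensRange = V) : ∃ s : Γ(P, V), V ⊓ W = P.basicOpen s := by
  subst hV
  have h1 : ι.opensRange ⊓ W = ι ''ᵁ (Spec R).basicOpen ((Scheme.ΓSpecIso R).inv e) := by
    rw [← Scheme.Hom.image_preimage_eq_opensRange_inf, h, ← basicOpen_eq_of_affine]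
  rw [Scheme.image_basicOpen] at h1
  -- transport the section from `Γ(P, ι(⊤))` to `Γ(P, range ι)` (the same open)
  refine ⟨P.presheaf.map (eqToHom ι.image_top_eq_opensRange.symm).op
    ((ι.appIso ⊤).inv ((Scheme.ΓSpecIso R).inv e)), ?_⟩
  rw [Scheme.basicOpen_res, h1]
  exact (inf_eq_right.mpr ((P.basicOpen_le _).trans ι.image_top_eq_opensRange.le)).symm

/-- **`D₊(f) ∩ D₊(g)` is a principal open of the affine `D₊(f)`** for `f`, `g` homogeneous of positive degree
(`= D(g^{deg f}/f^{deg g})` under `D₊(f) ≅ Spec S_{(f)}`, Mathlib `Proj.awayι_preimage_basicOpen`).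
[cite: Hartshorne1977, II Prop. 2.5 (b) and proof (pp. 76–77)] [cite: StacksProject, Tag 00JP] -/
theorem Proj.exists_basicOpen_inf_eq {A : Type u} {σ : Type*} [CommRing A] [SetLike σ A] [AddSubgroupClass σ A]
    (𝒜 : ℕ → σ) [GradedRing 𝒜] {f g : A} {m m' : ℕ} (f_deg : f ∈ 𝒜 m) (hm : 0 < m) (g_deg : g ∈ 𝒜 m')
    (hm' : 0 < m') :
    ∃ s : Γ(Proj 𝒜, Proj.basicOpen 𝒜 f), Proj.basicOpen 𝒜 f ⊓ Proj.basicOpen 𝒜 g = (Proj 𝒜).basicOpen s :=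
  exists_basicOpen_eq_opensRange_inf (Proj.awayι 𝒜 f f_deg hm) (Proj.basicOpen 𝒜 g)
    (HomogeneousLocalization.Away.isLocalizationElem f_deg g_deg)
    (Proj.awayι_preimage_basicOpen 𝒜 f_deg hm g_deg hm') (Proj.opensRange_awayι 𝒜 f f_deg hm)

/-! ### §2 Schemes affine over a `Proj` -/

/-- **A scheme affine over `Proj 𝒜` has a principal affine cover**: for `q : X → Proj 𝒜` affine and homogeneous
`f_a` of positive degree with `⋃ D₊(f_a) = Proj 𝒜`, the opens `U a := q⁻¹ D₊(f_a)` are affine, cover `X`, and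
`U a ∩ U c = D(b_{ac})` with `b_{ac} = q♯(g^{deg f}/f^{deg g}) ∈ Γ(X, U a)`.
[cite: Hartshorne1977, II Prop. 2.5 (b) and proof (pp. 76–77)] [cite: StacksProject, Tag 01JS] -/
theorem exists_principal_affine_cover_of_isAffineHom_toProj {A : Type u} {σ : Type*} [CommRing A] [SetLike σ A]
    [AddSubgroupClass σ A] (𝒜 : ℕ → σ) [GradedRing 𝒜] {X : Scheme.{u}} (q : X ⟶ Proj 𝒜) [IsAffineHom q]
    {ι : Type*} (f : ι → A) {d : ι → ℕ} (hd : ∀ a, 0 < d a) (hf : ∀ a, f a ∈ 𝒜 (d a))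
    (hcov : ⨆ a, Proj.basicOpen 𝒜 (f a) = ⊤) :
    ∃ (U : ι → X.affineOpens) (b : (a c : ι) → Γ(X, (U a).1)),
      (∀ a, (U a).1 = q ⁻¹ᵁ Proj.basicOpen 𝒜 (f a)) ∧ (⨆ a, (U a).1 = ⊤) ∧
      ∀ a c, (U a).1 ⊓ (U c).1 = X.basicOpen (b a c) := by
  choose s hs using fun a c => Proj.exists_basicOpen_inf_eq 𝒜 (hf a) (hd a) (hf c) (hd c)
  refine ⟨fun a => ⟨q ⁻¹ᵁ Proj.basicOpen 𝒜 (f a), (Proj.isAffineOpen_basicOpen 𝒜 (f a) (hf a) (hd a)).preimage q⟩,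
    fun a c => q.app (Proj.basicOpen 𝒜 (f a)) (s a c), fun a => rfl, q.iSup_preimage_eq_top hcov, fun a c => ?_⟩
  change q ⁻¹ᵁ Proj.basicOpen 𝒜 (f a) ⊓ q ⁻¹ᵁ Proj.basicOpen 𝒜 (f c) = _
  rw [← Scheme.Hom.preimage_inf, hs, Scheme.preimage_basicOpen]

/-! ### §3 Projective over an affine base -/

/-- **A scheme projective over an affine base has a finite principal affine cover** (★ `IsProjective`: a closed
immersion `j : X ↪ 𝐏(ι; Y) = Y ×_ℤ ℙⁿ_ℤ` over `Y`; `Y` affine): pull the standard opens `D₊(xᵢ)` of `ℙⁿ_ℤ` back along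
the AFFINE composite `X ↪ 𝐏(ι; Y) → ℙⁿ_ℤ` (a closed immersion followed by a base change of the affine `Y → Spec ℤ`).
[cite: Hartshorne1977, II Prop. 2.5 (b) and proof (pp. 76–77)] [cite: Hartshorne1977, II §4 Definition p.103 (projective morphism)]
[cite: StacksProject, Tag 01JS] -/
theorem exists_principal_affine_cover_of_isProjective {X Y : Scheme.{u}} [IsAffine Y] {f : X ⟶ Y}
    (hf : IsProjective f) :
    ∃ (ι : Type u) (_ : Finite ι) (U : ι → X.affineOpens) (b : (a c : ι) → Γ(X, (U a).1)),
      (⨆ a, (U a).1 = ⊤) ∧ ∀ a c, (U a).1 ⊓ (U c).1 = X.basicOpen (b a c) := by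
  obtain ⟨κ, _, j, hj, -⟩ := hf
  haveI : IsClosedImmersion j := hj
  -- the grading of `ℤ[x₀, …, xₙ]` behind `projectiveSpaceInt κ = Proj (grading κ)` (a local `letI`, no attribute)
  letI : GradedRing (grading κ) := MvPolynomial.gradedAlgebra
  -- the variables generate the irrelevant ideal (as in ★ `Motives.ProjectiveSpace.irrelevant_le_span`, there over a
  -- field), so the `D₊(xᵢ)` cover `ℙⁿ_ℤ`
  have hcovX : ⨆ i : Fin (Nat.card κ + 1), Proj.basicOpen (grading κ)
      (MvPolynomial.X i : MvPolynomial (Fin (Nat.card κ + 1)) intU.{u}) = ⊤ := by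
    apply Proj.iSup_basicOpen_eq_top
    rw [HomogeneousIdeal.toIdeal_irrelevant_le]
    intro i hi p (hp : p ∈ grading κ i)
    change p ∈ Ideal.span _
    rw [← Set.image_univ, MvPolynomial.mem_ideal_span_X_image]
    intro m hm
    have hdeg : m.degree = i := by
      rw [Finsupp.degree_eq_weight_one]
      exact hp (MvPolynomial.mem_support_iff.mp hm)
    by_contra! h
    refine hi.ne' (hdeg.symm.trans ((Finsupp.degree_eq_zero_iff m).mpr ?_))
    ext s
    simpa using h s
  haveI h₁ : IsAffineHom j := inferInstance
  haveI h₂ : IsAffineHom (pullback.snd (terminal.from Y) (terminal.from (projectiveSpaceInt κ))) :=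
    MorphismProperty.pullback_snd _ _ inferInstance
  haveI : IsAffineHom (j ≫ pullback.snd (terminal.from Y) (terminal.from (projectiveSpaceInt κ))) :=
    MorphismProperty.comp_mem _ _ _ h₁ h₂
  obtain ⟨U, b, -, hcov, hb⟩ := exists_principal_affine_cover_of_isAffineHom_toProj (grading κ)
    (j ≫ pullback.snd (terminal.from Y) (terminal.from (projectiveSpaceInt κ)))
    (fun i : Fin (Nat.card κ + 1) => (MvPolynomial.X i : MvPolynomial (Fin (Nat.card κ + 1)) intU.{u}))
    (d := fun _ => 1) (fun _ => zero_lt_one) (fun i => ProjectiveSpace.X_mem (R := intU.{u}) i) hcovX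
  refine ⟨ULift.{u} (Fin (Nat.card κ + 1)), inferInstance, fun a => U a.down, fun a c => b a.down c.down, ?_,
    fun a c => hb a.down c.down⟩
  rw [← hcov]
  exact le_antisymm (iSup_le fun a => le_iSup (fun i => (U i).1) a.down)
    (iSup_le fun i => le_iSup (fun a : ULift.{u} (Fin (Nat.card κ + 1)) => (U a.down).1) ⟨i⟩)

end Literature.AlgebraicGeometry.Morphisms

end
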